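import Literature.AnabelianGeometry.SemiGraphs.ArithDecompositionDataProofs
import Literature.AnabelianGeometry.SemiGraphs.TemperedEdgeLikeDistinctProofs
import Literature.AnabelianGeometry.SemiGraphs.TemperedVerticialDistinctSameVertex
import Literature.AnabelianGeometry.SemiGraphs.ArithIntersectionWithGeometricProofs
import HarnessLib

/-!
# [SemiAnbd] §5: every edge-like subgroup of `Π^temp_𝔊` lies in two DISTINCT verticial subgroups (proof-only)

Mochizuki, *Semi-graphs of Anabelioids*, Publ. RIMS **42** (2006) 221–322, §5, Thm 5.4 (i) p. 66 ("If an
arithmetically ample compact subgroup of `π₁^temp(𝔊)` is contained in more than one verticial subgroup,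
then it is contained in precisely two verticial subgroups, whose intersection forms an edge-like
subgroup") with §3 Thm 3.7 (iii)/(iv) p. 41 ("determined by a compatible system of pairs of vertices …
joined to one another by a single [closed] edge") [cite: MochizukiSemiAnbd2006, Thm 5.4 (i), p. 66] and
the commensurator description of the decomposition groups, p. 65.

PROOF-ONLY companion (abc-iut cell, L3 sub-DAG #4 `plan/L3/SUBDAG-SemiAnbd-Thm54.md`, coordinator
abc-iut-w4-d085's interface menu v2, item **hβ₁** «every edge-like subgroup lies in two DISTINCT verticial
hosts», row T54-4d, seat abc-iut-w4-d040) at LEVEL A = over the PRODUCED data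
`decompositionDataOfChart R ι` of abc-iut-w4-d053 (`ArithDecompositionData.lean`: `Π^temp_{𝔊,v} :=` the
commensurator of `ι(Π^temp_{𝔾,v})`, `Π^temp_{𝔊,b} := Π^temp_{𝔊,v} ∩` the commensurator of `ι(Π^temp_{𝔾,b})`).
No definition, no new named fact.

Route.  (GEOMETRIC) In `π₁^temp(𝒢)` an edge-like subgroup `L` of a CLOSED edge `e` with branches
`b ≠ b′` at `u`, `u′` is `g·φ_u(Π_b)·g⁻¹ = g′·φ_{u′}(Π_{b′})·g′⁻¹` and so lies in the two verticial hosts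
`g·φ_u(Π_u)·g⁻¹`, `g′·φ_{u′}(Π_{u′})·g′⁻¹`, which are DISTINCT by abc-iut-L3-t11's LEMMA E
(`branch_eq_of_hosts_eq`: equal hosts would force `b = b′`) — the first half of t11's proof of
`edgeLikeIsInfVerticial_of`, which needs only Thm 3.7 (i)(ii) (`verticialInjective_holds`,
`verticialDistinct_holds`, both discharged) and NOT `CompactInVerticial`:
`exists_two_hosts_of_mem_edgeLikeSubgroups` (unconditional under `Thm37Hypotheses`).
(ARITHMETIC) an edge-like subgroup `K = x·Π^temp_{𝔊,b}·x⁻¹` of the produced data lies in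
`x·C(ι Π^temp_{𝔾,b})·x⁻¹`; the geometric `Π^temp_{𝔾,b}` has two distinct geometric hosts `H₁ ≠ H₂`; the
arithmetic hosts are `Wᵢ := x·C(ι Hᵢ)·x⁻¹` — verticial for the produced data
(`isVerticial_decompositionDataOfChart_iff`), DISTINCT because `C(ι Hᵢ) ∩ ι(π₁^temp) = ι(C(Hᵢ)) = ι(Hᵢ)`
(verticial subgroups are commensurably terminal, Thm 3.7 (ii): `commensurator_eq_of_mem_verticialSubgroups`),
and CONTAINING `K` provided
  (H-CE) `C(ι L) ≤ C(ι H)` for a geometric edge-like `L` inside a geometric verticial host `H`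
— the ONE producer input, which is exactly where Theorem 5.4's hypothesis "the arithmetic actions … do
not switch the branches of any edge" enters the data (coordinator ruling R10: "an element commensurating
`Π_{𝔾,e}` fixes the pro-tree edge, cannot switch its ends, so lies in the vertex commensurator"); it is
NOT provable at LEVEL A (no `Π^temp_𝔊`-action on the coverings is recorded there) and is kept as an
explicit hypothesis, never a `def … : Prop`.  Result: `exists_two_hosts_of_isEdgeLike_ofChart`.

Nothing here takes a side on [IUTchIII] Cor. 3.12; typed ≠ proved elsewhere.
-/

namespace Literature.AnabelianGeometry.SemiGraphs

namespace ProfiniteSemiGraph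

open CategoryTheory Topology
open scoped Pointwise

universe u u'

variable {𝒢 : ProfiniteSemiGraph.{u}}

/-! ### Geometric side: commensurable terminality and the two hosts of an edge-like subgroup -/

/-- **Verticial subgroups of `π₁^temp(𝒢)` are commensurably terminal** (Thm 3.7 (ii), second clause of the
tree's `VerticialDistinct`, discharged as `verticialDistinct_holds`): `C(H) = H`.
[cite: MochizukiSemiAnbd2006, Thm 3.7 (ii), p. 40] -/
theorem commensurator_eq_of_mem_verticialSubgroups (h𝒢 : 𝒢.Thm37Hypotheses) (c : TemperedPiChart 𝒢)
    {v : 𝒢.graph.Vertex} {H : Subgroup c.G} (hH : H ∈ verticialSubgroups c v) :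
    Subgroup.Commensurable.commensurator H = H := by
  refine le_antisymm (fun g hg => ?_) (le_commensurator_self H)
  by_contra hgH
  have h0 := (verticialDistinct_holds 𝒢 h𝒢 c).2 v H hH 1 g (by simpa using hgH)
  rw [Subgroup.Commensurable.commensurator_mem_iff] at hg
  have h1 : H.map (MulAut.conj (1 : c.G)).toMonoidHom = H := by ext x; simp
  have h2 : H.map (MulAut.conj g).toMonoidHom = ConjAct.toConjAct g • H := rfl
  rw [h1, h2] at h0
  exact hg.1 h0

/-- **The two hosts of an edge-like subgroup** (Thm 3.7 (iii)/(iv) p. 41: an edge-like subgroup of a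
closed edge lies in the verticial subgroups of BOTH end-branches, and these are distinct — abc-iut-L3-t11's
LEMMA E `branch_eq_of_hosts_eq`; the first half of t11's `edgeLikeIsInfVerticial_of`, which does not use
`CompactInVerticial`), UNCONDITIONAL under `Thm37Hypotheses`: for `L ∈ edgeLikeSubgroups c e` and two
distinct abutting branches `b ≠ b′` of `e`, there are DISTINCT verticial `H₁ ∋ L`, `H₂ ∋ L` at their vertices.
[cite: MochizukiSemiAnbd2006, Thm 3.7 (iii), p. 41] -/
theorem exists_two_hosts_of_mem_edgeLikeSubgroups (h𝒢 : 𝒢.Thm37Hypotheses) (c : TemperedPiChart 𝒢)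
    {b b' : 𝒢.graph.Branch} (hbb' : b ≠ b') (he : 𝒢.graph.edgeOf b' = 𝒢.graph.edgeOf b)
    {u u' : 𝒢.graph.Vertex} (hb : 𝒢.graph.abuts b = some u) (hb' : 𝒢.graph.abuts b' = some u')
    {L : Subgroup c.G} (hL : L ∈ edgeLikeSubgroups c (𝒢.graph.edgeOf b)) :
    ∃ H₁ H₂ : Subgroup c.G, H₁ ∈ verticialSubgroups c u ∧ H₂ ∈ verticialSubgroups c u' ∧ H₁ ≠ H₂ ∧
      L ≤ H₁ ∧ L ≤ H₂ := by
  classical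
  have hVD := verticialDistinct_holds.{u}
  have hVI := verticialInjective_holds.{u}
  have hΦ' : ∀ v : 𝒢.graph.Vertex, ∃ φ : 𝒢.Gv v →ₜ* c.G, IsVerticialHom c v φ := by
    intro v
    obtain ⟨H, φ, hφ, -⟩ := (hVI 𝒢 h𝒢 c v).1
    exact ⟨φ, hφ⟩
  choose Φ hΦ using hΦ'
  -- the two presentations of `L` along `b` and `b'`
  obtain ⟨g, hLeq⟩ := edgeLike_eq_map_branchSubgroup c hb hL (Φ u) (hΦ u)
  have hLb' : L ∈ edgeLikeSubgroups c (𝒢.graph.edgeOf b') := by rw [he]; exact hL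
  obtain ⟨g', hLeq'⟩ := edgeLike_eq_map_branchSubgroup c hb' hLb' (Φ u') (hΦ u')
  refine ⟨(Φ u).toMonoidHom.range.map (MulAut.conj g).toMonoidHom,
    (Φ u').toMonoidHom.range.map (MulAut.conj g').toMonoidHom,
    conj_mem_verticialSubgroups c (range_mem_verticialSubgroups c (Φ u) (hΦ u)) g,
    conj_mem_verticialSubgroups c (range_mem_verticialSubgroups c (Φ u') (hΦ u')) g', ?_, ?_, ?_⟩
  · -- distinct hosts: LEMMA E (equal hosts ⇒ `b = b'`)
    haveI := infinite_of_mem_edgeLikeSubgroups hVI h𝒢 c hL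
    have hLne : L ≠ ⊥ := fun h => by
      rw [h] at this
      exact not_finite (⊥ : Subgroup c.G)
    intro hHH'
    refine hbb' (branch_eq_of_hosts_eq hVD hVI h𝒢 c Φ hΦ hLne hb hb' g g' ?_ ?_ hHH')
    · rw [← hLeq]
    · rw [← hLeq']
  · rw [hLeq]; exact Subgroup.map_mono (Subgroup.map_le_range _ _)
  · rw [hLeq']; exact Subgroup.map_mono (Subgroup.map_le_range _ _)

/-- The same with the second branch found from the semi-graph axiom "every edge has exactly two branches"
and a vertex for it in a GRAPH (every branch abuts; the frame of Thm 5.4: graphs of anabelioids).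
[cite: MochizukiSemiAnbd2006, Thm 3.7 (iii) / Thm 5.4, pp. 41, 66] -/
theorem exists_two_hosts_of_mem_edgeLikeSubgroups_of_isGraph (h𝒢 : 𝒢.Thm37Hypotheses)
    (hG : 𝒢.graph.IsGraph) (c : TemperedPiChart 𝒢) (b : 𝒢.graph.Branch) {L : Subgroup c.G}
    (hL : L ∈ edgeLikeSubgroups c (𝒢.graph.edgeOf b)) :
    ∃ (u u' : 𝒢.graph.Vertex) (H₁ H₂ : Subgroup c.G), H₁ ∈ verticialSubgroups c u ∧
      H₂ ∈ verticialSubgroups c u' ∧ H₁ ≠ H₂ ∧ L ≤ H₁ ∧ L ≤ H₂ := by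
  obtain ⟨b₁, b₂, h12, h1e, h2e, hall⟩ := 𝒢.graph.two_branches (𝒢.graph.edgeOf b)
  -- the OTHER branch of the edge of `b`
  obtain ⟨b', hbb', he⟩ : ∃ b', b ≠ b' ∧ 𝒢.graph.edgeOf b' = 𝒢.graph.edgeOf b := by
    rcases hall b rfl with rfl | rfl
    · exact ⟨b₂, h12, h2e⟩
    · exact ⟨b₁, Ne.symm h12, h1e⟩
  obtain ⟨u, hb⟩ := Option.isSome_iff_exists.mp (hG.abuts_isSome b)
  obtain ⟨u', hb'⟩ := Option.isSome_iff_exists.mp (hG.abuts_isSome b')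
  obtain ⟨H₁, H₂, h₁, h₂, hne, hL₁, hL₂⟩ :=
    exists_two_hosts_of_mem_edgeLikeSubgroups h𝒢 c hbb' he hb hb' hL
  exact ⟨u, u', H₁, H₂, h₁, h₂, hne, hL₁, hL₂⟩

/-! ### The commensurator of an image determines a commensurably terminal subgroup
(`C(ι H) ∩ ι(π₁^temp) = ι(C(H))` is abc-iut-w4-d053's `commensurator_map_inf_range`, `ArithDecompositionDataProofs`). -/

/-- Hence the commensurator of the image DETERMINES a commensurably terminal subgroup: for verticial
`H₁`, `H₂` with `C(ι H₁) = C(ι H₂)` one has `H₁ = H₂`. [cite: MochizukiSemiAnbd2006, Thm 3.7 (ii) / §5, pp. 40, 65] -/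
theorem eq_of_commensurator_map_eq (h𝒢 : 𝒢.Thm37Hypotheses) (c : TemperedPiChart 𝒢)
    {Gtp : Type u'} [Group Gtp] (ι : c.G →* Gtp) (hι : Function.Injective ι)
    {v₁ v₂ : 𝒢.graph.Vertex} {H₁ H₂ : Subgroup c.G} (h₁ : H₁ ∈ verticialSubgroups c v₁)
    (h₂ : H₂ ∈ verticialSubgroups c v₂)
    (h : Subgroup.Commensurable.commensurator (H₁.map ι) = Subgroup.Commensurable.commensurator (H₂.map ι)) :
    H₁ = H₂ := by
  have h' : Subgroup.Commensurable.commensurator (H₁.map ι) ⊓ ι.range =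
      Subgroup.Commensurable.commensurator (H₂.map ι) ⊓ ι.range := by rw [h]
  rw [commensurator_map_inf_range hι, commensurator_map_inf_range hι,
    commensurator_eq_of_mem_verticialSubgroups h𝒢 c h₁,
    commensurator_eq_of_mem_verticialSubgroups h𝒢 c h₂] at h'
  exact Subgroup.map_injective hι h'

/-! ### Arithmetic side: two distinct verticial hosts of every edge-like subgroup of the produced data -/

variable {c : TemperedPiChart 𝒢} {Gtp : Type u'} [Group Gtp]

/-- **hβ₁ at LEVEL A** (menu item of the Thm 5.4 assembly; print: Thm 5.4 (i) second sentence / Thm 3.7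
(iii)(iv)): for the produced decomposition data of a GRAPH of anabelioids `𝒢` satisfying the hypotheses of
Thm 3.7, EVERY edge-like subgroup `K` of `Π^temp_𝔊 = Gtp` lies in two DISTINCT verticial subgroups —
GIVEN the one producer input (H-CE) "the commensurator of the image of a geometric edge-like subgroup lies
in the commensurator of the image of each of its geometric verticial hosts" (= where Theorem 5.4's
hypothesis «the arithmetic actions … do not switch the branches of any edge» enters the data).  Hosts:
`x·C(ι H₁)·x⁻¹ ≠ x·C(ι H₂)·x⁻¹` for the two distinct geometric hosts `H₁ ≠ H₂` of the geometric edge-like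
representative. [cite: MochizukiSemiAnbd2006, Thm 5.4 (i), p. 66] -/
theorem exists_two_hosts_of_isEdgeLike_ofChart (h𝒢 : 𝒢.Thm37Hypotheses) (hG : 𝒢.graph.IsGraph)
    (R : ChartRepresentatives c) (ι : c.G →* Gtp) (hι : Function.Injective ι)
    (hCE : ∀ (e : 𝒢.graph.Edge) (v : 𝒢.graph.Vertex) (L H : Subgroup c.G),
      L ∈ edgeLikeSubgroups c e → H ∈ verticialSubgroups c v → L ≤ H →
        Subgroup.Commensurable.commensurator (L.map ι) ≤
          Subgroup.Commensurable.commensurator (H.map ι))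
    (K : Subgroup Gtp) (hK : IsEdgeLike (decompositionDataOfChart R ι) K) :
    ∃ W₁ W₂ : Subgroup Gtp, IsVerticial (decompositionDataOfChart R ι) W₁ ∧
      IsVerticial (decompositionDataOfChart R ι) W₂ ∧ W₁ ≠ W₂ ∧ K ≤ W₁ ∧ K ≤ W₂ := by
  obtain ⟨b, x, rfl⟩ := hK
  -- the geometric edge-like representative of `b` and its two distinct geometric hosts
  obtain ⟨u, u', H₁, H₂, hH₁, hH₂, hne, hL₁, hL₂⟩ :=
    exists_two_hosts_of_mem_edgeLikeSubgroups_of_isGraph h𝒢 hG c b (R.Hb_mem b)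
  obtain ⟨v, hbv⟩ := Option.isSome_iff_exists.mp (hG.abuts_isSome b)
  refine ⟨conjSubgroup x (Subgroup.Commensurable.commensurator (H₁.map ι)),
    conjSubgroup x (Subgroup.Commensurable.commensurator (H₂.map ι)),
    (isVerticial_decompositionDataOfChart_iff R ι _).mpr ⟨u, H₁, x, hH₁, rfl⟩,
    (isVerticial_decompositionDataOfChart_iff R ι _).mpr ⟨u', H₂, x, hH₂, rfl⟩, ?_, ?_, ?_⟩
  · -- distinct: strip `x`, compare the geometric parts
    intro hW
    have hinj : Function.Injective (conjSubgroup x : Subgroup Gtp → Subgroup Gtp) :=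
      Subgroup.map_injective (MulAut.conj x).injective
    exact hne (eq_of_commensurator_map_eq h𝒢 c ι hι hH₁ hH₂ (hinj hW))
  · -- `K ≤ W₁`: `Π^temp_{𝔊,b} ≤ C(ι Π^temp_{𝔾,b}) ≤ C(ι H₁)` (H-CE)
    change conjSubgroup x (arithBrGp R ι b) ≤ _
    refine Subgroup.map_mono ?_
    rw [arithBrGp_of_abuts R ι hbv]
    exact inf_le_right.trans (hCE _ _ _ _ (R.Hb_mem b) hH₁ hL₁)
  · change conjSubgroup x (arithBrGp R ι b) ≤ _
    refine Subgroup.map_mono ?_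
    rw [arithBrGp_of_abuts R ι hbv]
    exact inf_le_right.trans (hCE _ _ _ _ (R.Hb_mem b) hH₂ hL₂)

/-- The conclusion in the exact shape of the menu item **hβ₁** (quantified over all edge-like `K`).
[cite: MochizukiSemiAnbd2006, Thm 5.4 (i), p. 66] -/
theorem hβ₁_ofChart (h𝒢 : 𝒢.Thm37Hypotheses) (hG : 𝒢.graph.IsGraph) (R : ChartRepresentatives c)
    (ι : c.G →* Gtp) (hι : Function.Injective ι)
    (hCE : ∀ (e : 𝒢.graph.Edge) (v : 𝒢.graph.Vertex) (L H : Subgroup c.G),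
      L ∈ edgeLikeSubgroups c e → H ∈ verticialSubgroups c v → L ≤ H →
        Subgroup.Commensurable.commensurator (L.map ι) ≤
          Subgroup.Commensurable.commensurator (H.map ι)) :
    ∀ K : Subgroup Gtp, IsEdgeLike (decompositionDataOfChart R ι) K →
      ∃ W₁ W₂ : Subgroup Gtp, IsVerticial (decompositionDataOfChart R ι) W₁ ∧
        IsVerticial (decompositionDataOfChart R ι) W₂ ∧ W₁ ≠ W₂ ∧ K ≤ W₁ ∧ K ≤ W₂ :=
  fun K hK => exists_two_hosts_of_isEdgeLike_ofChart h𝒢 hG R ι hι hCE K hK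

/-! ### LEVEL A vertex facts: the geometric part of `Π^temp_{𝔊,v}` and the commensurator description -/

/-- **`Π^temp_{𝔊,v} ∩ Π^temp_𝔾 = Π^temp_{𝔾,v}`** for the PRODUCED data (p. 65 "`Π^temp_{𝔾,v} := Π^temp_{𝔊,v} ∩ Π^temp_𝔾`",
read as a property of the commensurator `Π^temp_{𝔊,v} := C(ι Π^temp_{𝔾,v})`): the elements of `ι(π₁^temp(𝒢))`
commensurating `ι(H_v)` are `ι(C(H_v)) = ι(H_v)`, verticial subgroups being commensurably terminal
(Thm 3.7 (ii)).  This is the vertex half of the T54-2 input (H-DEF) at LEVEL A — abc-iut-w4-d053's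
`arithVertGp_inf_range_of_commTerminal` with its commensurable-terminality input `hct` DISCHARGED by
`commensurator_eq_of_mem_verticialSubgroups` (Thm 3.7 (ii)).
[cite: MochizukiSemiAnbd2006, §5, p. 65] -/
theorem arithVertGp_inf_range_eq_map (h𝒢 : 𝒢.Thm37Hypotheses) (R : ChartRepresentatives c)
    (ι : c.G →* Gtp) (hι : Function.Injective ι) (v : 𝒢.graph.Vertex) :
    arithVertGp R ι v ⊓ ι.range = (R.Hv v).map ι :=
  arithVertGp_inf_range_of_commTerminal R hι (commensurator_eq_of_mem_verticialSubgroups h𝒢 c (R.Hv_mem v))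

/-- **Menu item `hcomm_v` at LEVEL A** ("`Π^temp_{𝔊,v}` … the commensurator in `Π^temp_𝔊` of
`Π^temp_{𝔾,v} := Π^temp_{𝔊,v} ∩ Π^temp_𝔾`", p. 65): the produced vertex group IS the commensurator of its
geometric part. [cite: MochizukiSemiAnbd2006, §5, p. 65] -/
theorem commensurator_arithVertGp_inf_range (h𝒢 : 𝒢.Thm37Hypotheses) (R : ChartRepresentatives c)
    (ι : c.G →* Gtp) (hι : Function.Injective ι) (v : 𝒢.graph.Vertex) :
    Subgroup.Commensurable.commensurator (arithVertGp R ι v ⊓ ι.range) = arithVertGp R ι v := by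
  rw [arithVertGp_inf_range_eq_map h𝒢 R ι hι v]
  rfl

/-- The two vertex facts in the currency of `DecompositionData` / `aug` (Prop 5.2 (iv):
`ι(Π^temp_𝔾) = Ker(Π^temp_𝔊 ↠ Π_A)`, the middle clause of `FundamentalExactSequences.exact_tp`): (H-DEF)ᵥ
"`vertGp v ∩ Ker aug` is the image of a verticial subgroup at `v`" and `hcomm_v` for the produced data —
the vertex inputs of `intersectionWithGeometricStatement_of_chart` / `isVerticial_eq_of_le`
(`ArithIntersectionWithGeometricProofs`), DISCHARGED at LEVEL A. [cite: MochizukiSemiAnbd2006, §5, p. 65] -/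
theorem decompositionDataOfChart_vertGp_inf_ker (h𝒢 : 𝒢.Thm37Hypotheses) (R : ChartRepresentatives c)
    (ι : c.G →* Gtp) (hι : Function.Injective ι) {PA : Type*} [Group PA] (aug : Gtp →* PA)
    (hexact : ι.range = aug.ker) (v : 𝒢.graph.Vertex) :
    (∃ w : 𝒢.graph.Vertex, ∃ H ∈ verticialSubgroups c w,
        (decompositionDataOfChart R ι).vertGp v ⊓ aug.ker = H.map ι) ∧
      Subgroup.Commensurable.commensurator ((decompositionDataOfChart R ι).vertGp v ⊓ aug.ker) =
        (decompositionDataOfChart R ι).vertGp v := by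
  rw [decompositionDataOfChart_vertGp, ← hexact, arithVertGp_inf_range_eq_map h𝒢 R ι hι v]
  exact ⟨⟨v, R.Hv v, R.Hv_mem v, rfl⟩, rfl⟩

end ProfiniteSemiGraph

end Literature.AnabelianGeometry.SemiGraphs
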